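import Mathlib
import Summits.PneNP.PneNP.Theorems.ConvexRankGatesConvexGateBlindNegCover
import Summits.PneNP.PneNP.Theorems.ConvexRankGatesConvexGateBlindNegCoverConverse
import Summits.PneNP.PneNP.Theorems.ConvexRankGatesConvexGateBlindNegCoverCatch
import Summits.PneNP.PneNP.Theorems.ConvexRankGatesConvexGateBlindSmallSymmetric

/-!
# PneNP / ConvexRankGates — `ConvexGateBlind`: the column-space (restricted non-negative rank) LP slice of the crux is TRUE

Helpers (`--supports stmt-PneNP-10680`), COLUMN-SPACE line (prover seat 2, session 13) — the headline.

By the canonical form (`convexGateBlind_iff_cliqueDistConeRankHard`) the LP slice of the crux asks that for every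
`ε > 0` the matrix `D − εJ`, `D[Q,u] = cdist Q u = #(E(Q) ∖ u)` (`Q` a `k`-set, `u` a `k`-clique-free graph of `K_m`,
`k = ⌈m^δ⌉₊`), has no non-negative factorisation `cdist Q u − ε = ∑_l U_l(u) V_l(Q)` with `m^{O(1)}` terms. The column
space of `D` (as functions of `Q`) is `X(ℝ^E) = span{Q ↦ [e ⊆ Q]}`; a factorisation is RESTRICTED if its row objects lie
there, `V_l(Q) = t_l(E(Q))` for edge weightings `t_l` (then `V_l ≥ 0` says `t_l` is `k`-clique-non-negative) — the
restricted non-negative rank of Gillis–Glineur, containing the trivial factorisation of `D` (`ε = 0`, `C(m,2)` terms) and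
every rank-tight factorisation. `…NegCoverConverse.lean` turns a restricted factorisation into a NEGATIVE COVER, every
complete `(k−1)`-partite graph `colorVec c` is covered by a generator `t_l` with `t_l(colorVec c) < 0`
(`exists_neg_sum_of_negCover`), and `…NegCoverCatch.lean` bounds the number of colourings one generator covers by
`(k−1)^m·exp(−1/(512L²√β))`. Hence:

* `restricted_terms_lower_bound` — at fixed `m` (`4 ≤ k`, `k + 2 ≤ m`): a restricted factorisation with `R` terms has
  `(k−1)^m − (k−1) ≤ R·(k−1)^m·exp(−1/(512L²√β))`, `L = 2k²−4k+1`, `β = C(k,2)(k−2)/(m−k)` — for EVERY `ε > 0`;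
* `eventually_catch_exponent` — for `δ < 1/11`: eventually `m^c·exp(−1/(512L²√β)) ≤ 1/4` (`E ≥ m^{(1−11δ)/2}/2^{17}`);
* `columnSpace_cliqueDistConeRankHard` (stub `columnSpace_crux`) — **for every `δ ∈ (0, 1/11)` and every `c`, eventually
  in `m`, for every `ε > 0`: NO restricted non-negative factorisation of the LP slice with `R ≤ m^c` terms exists.**
  This is the LP slice of the crux for the class of column-space row objects, in the crux's own quantifier order
  (`m` first, then all `ε`), ε-free; together with `…JuntaHard.lean` (juntas), `…SymmetricHard.lean` (symmetric
  families) it is the third structured class settled, and the first defined by LINEAR rather than combinatorial structure.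
[new]
-/

set_option linter.dupNamespace false

namespace Summit.PneNP.PneNP.Theorems

open Finset Real Filter Literature.Computability.Complexity
open Summit.PneNP.PneNP.Cruxes.ConvexGateBlind.StrictRankConicCover (Edge cdist)

noncomputable section

/-! ## Fixed `m`: restricted factorisations have many terms -/

/-- Clique sums in the `cliqueVec` form of `…NegCover.lean` are the `softWindow`s of `…SoftWindow.lean`. [folklore] -/
theorem sum_ite_cliqueVec_eq_softWindow {m : ℕ} (t : Edge m → ℝ) (Q : Finset (Fin m)) :
    ∑ e, (if cliqueVec Q e = true then t e else 0) = softWindow t Q := by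
  classical
  unfold softWindow
  rw [Finset.sum_filter]
  refine Finset.sum_congr rfl fun e _ => ?_
  simp only [cliqueVec_eq_true_iff_edgeVerts_subset]

/-- A non-constant colouring has a bichromatic edge. [folklore] -/
theorem exists_colorVec_eq_true {m K : ℕ} (c : Fin m → Fin K) (h : ∃ x y, c x ≠ c y) : ∃ e, colorVec c e = true := by
  obtain ⟨x, y, hxy⟩ := h
  have hne : x ≠ y := fun h => hxy (h ▸ rfl)
  refine ⟨⟨s(x, y), CliqueExtLowerBound.Negative.mk_mem_edgeSet_top hne⟩, ?_⟩
  simpa [colorVec] using hxy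

/-- All but at most `K` colourings `Fin m → Fin K` are non-constant (`0 < m`). [folklore] -/
theorem card_filter_nonconstant_ge {m K : ℕ} (hm : 0 < m) :
    K ^ m ≤ (((Finset.univ : Finset (Fin m → Fin K)).filter fun c => ∃ x y, c x ≠ c y).card) + K := by
  classical
  have hconst : ((Finset.univ : Finset (Fin m → Fin K)).filter fun c => ¬ ∃ x y, c x ≠ c y) ⊆
      (Finset.univ : Finset (Fin K)).image (fun i => fun _ : Fin m => i) := by
    intro c hc
    rw [Finset.mem_filter] at hc
    push Not at hc
    refine Finset.mem_image.2 ⟨c ⟨0, hm⟩, Finset.mem_univ _, ?_⟩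
    funext x
    exact hc.2 _ _
  have h1 := Finset.card_filter_add_card_filter_not (s := (Finset.univ : Finset (Fin m → Fin K)))
    (fun c => ∃ x y, c x ≠ c y)
  have h2 : ((Finset.univ : Finset (Fin m → Fin K)).filter fun c => ¬ ∃ x y, c x ≠ c y).card ≤ K :=
    (Finset.card_le_card hconst).trans (Finset.card_image_le.trans (by simp))
  rw [Finset.card_univ, Fintype.card_fun, Fintype.card_fin, Fintype.card_fin] at h1
  omega

/-- **Restricted factorisations have many terms (fixed `m`).** Let `4 ≤ k`, `k + 2 ≤ m`, `ε > 0`, `b ≥ 0`, edge weightings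
`t₁,…,t_R` with `t_l(E(Q)) ≥ 0` on `k`-sets, and suppose `cdist Q u − ε = ∑_l b_l(u)·t_l(E(Q))` for all `k`-sets `Q` and all
`k`-clique-free `u`. Then `(k−1)^m − (k−1) ≤ R·(k−1)^m·exp(−1/(512L²√β))`. (Negative cover; every non-constant colouring is
caught by some generator; each generator catches few.) [new] -/
theorem restricted_terms_lower_bound {m k R : ℕ} (hk : 4 ≤ k) (hm : k + 2 ≤ m)
    (t : Fin R → Edge m → ℝ) (ht : ∀ l (Q : Finset (Fin m)), Q.card = k → 0 ≤ ∑ e, if cliqueVec Q e = true then t l e else 0)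
    (b : (Edge m → Bool) → Fin R → ℝ) (hb : ∀ u l, 0 ≤ b u l) (ε : ℝ) (hε : 0 < ε)
    (hfact : ∀ (Q : Finset (Fin m)) (u : Edge m → Bool), Q.card = k → cliqueFn m k u = false →
      cdist Q u - ε = ∑ l, b u l * ∑ e, (if cliqueVec Q e = true then t l e else 0)) :
    ((k - 1 : ℕ) : ℝ) ^ m - ((k - 1 : ℕ) : ℝ) ≤ R * (((k - 1 : ℕ) : ℝ) ^ m *
      Real.exp (-(1 / (512 * (2 * (k : ℝ) ^ 2 - 4 * k + 1) ^ 2 *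
        Real.sqrt (((k : ℝ) * (k - 1) / 2) * ((k - 2) / (m - k))))))) := by
  classical
  -- the negative cover
  obtain ⟨μ, Λ, hμ, -, hneg, -⟩ := negCover_of_restrictedFactorisation (by omega) hm t b hb ε hε
    (fun Q u hQ hu => by rw [← hfact Q u hQ hu]; rfl)
  -- every non-constant colouring is caught by some generator
  set BAD : Fin R → Finset (Fin m → Fin (k - 1)) := fun l =>
    (Finset.univ : Finset (Fin m → Fin (k - 1))).filter fun c => ∑ e, (if colorVec c e = true then t l e else 0) < 0
    with hBAD
  have hcover : ((Finset.univ : Finset (Fin m → Fin (k - 1))).filter fun c => ∃ x y, c x ≠ c y) ⊆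
      (Finset.univ : Finset (Fin R)).biUnion BAD := by
    intro c hc
    rw [Finset.mem_filter] at hc
    have hcf : cliqueFn m k (colorVec c) = false := cliqueFn_colorVec c (by omega)
    obtain ⟨j, hj⟩ := exists_neg_sum_of_negCover t (μ (colorVec c)) (hμ (colorVec c)) (colorVec c)
      (exists_colorVec_eq_true c hc.2) (hneg (colorVec c) hcf)
    exact Finset.mem_biUnion.2 ⟨j, Finset.mem_univ _, Finset.mem_filter.2 ⟨Finset.mem_univ _, hj⟩⟩
  -- each generator catches few colourings
  have hcatch : ∀ l : Fin R, ((BAD l).card : ℝ) ≤ ((k - 1 : ℕ) : ℝ) ^ m *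
      Real.exp (-(1 / (512 * (2 * (k : ℝ) ^ 2 - 4 * k + 1) ^ 2 *
        Real.sqrt (((k : ℝ) * (k - 1) / 2) * ((k - 2) / (m - k)))))) := by
    intro l
    refine card_badColourings_le hk hm (t l) fun Q hQ => ?_
    rw [← sum_ite_cliqueVec_eq_softWindow]
    exact ht l Q (Finset.mem_powersetCard.1 hQ).2
  -- count
  have hnc := card_filter_nonconstant_ge (K := k - 1) (show 0 < m by omega)
  have h1 : (((Finset.univ : Finset (Fin m → Fin (k - 1))).filter fun c => ∃ x y, c x ≠ c y).card : ℝ) ≤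
      ∑ l : Fin R, ((BAD l).card : ℝ) := by
    have := (Finset.card_le_card hcover).trans Finset.card_biUnion_le
    exact_mod_cast this
  have h2 : ∑ l : Fin R, ((BAD l).card : ℝ) ≤ R * (((k - 1 : ℕ) : ℝ) ^ m *
      Real.exp (-(1 / (512 * (2 * (k : ℝ) ^ 2 - 4 * k + 1) ^ 2 *
        Real.sqrt (((k : ℝ) * (k - 1) / 2) * ((k - 2) / (m - k))))))) := by
    calc ∑ l : Fin R, ((BAD l).card : ℝ) ≤ ∑ _l : Fin R, ((k - 1 : ℕ) : ℝ) ^ m *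
          Real.exp (-(1 / (512 * (2 * (k : ℝ) ^ 2 - 4 * k + 1) ^ 2 *
            Real.sqrt (((k : ℝ) * (k - 1) / 2) * ((k - 2) / (m - k)))))) := Finset.sum_le_sum fun l _ => hcatch l
      _ = _ := by rw [Finset.sum_const, Finset.card_univ, Fintype.card_fin, nsmul_eq_mul]
  have h0 : (((k - 1 : ℕ) : ℝ)) ^ m ≤
      (((Finset.univ : Finset (Fin m → Fin (k - 1))).filter fun c => ∃ x y, c x ≠ c y).card : ℝ) + ((k - 1 : ℕ) : ℝ) := by
    exact_mod_cast hnc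
  linarith

/-! ## The exponent is eventually large -/

/-- **The catch exponent beats every polynomial (`δ < 1/11`).** With `k = ⌈m^δ⌉₊`: eventually `4 ≤ k`, `4k ≤ m` and
`m^c · exp(−1/(512·(2k²−4k+1)²·√(C(k,2)(k−2)/(m−k)))) ≤ 1/4`. (`L ≤ 2k²`, `β ≤ k³/m`, `k ≤ 2m^δ` give
`(512L²√β)² ≤ 2³³m^{11δ−1}`, so the exponent is `≥ m^γ/2^{17}`, `γ = (1−11δ)/2 > 0`, and `e^E ≥ E^n/n!` with `γn ≥ c+1`.) [new] -/
theorem eventually_catch_exponent {δ : ℝ} (hδ0 : 0 < δ) (hδ1 : δ < 1 / 11) (c : ℕ) :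
    ∀ᶠ m : ℕ in atTop, 4 ≤ ⌈(m : ℝ) ^ δ⌉₊ ∧ 4 * ⌈(m : ℝ) ^ δ⌉₊ ≤ m ∧
      (m : ℝ) ^ c * Real.exp (-(1 / (512 * (2 * (⌈(m : ℝ) ^ δ⌉₊ : ℝ) ^ 2 - 4 * ⌈(m : ℝ) ^ δ⌉₊ + 1) ^ 2 *
        Real.sqrt (((⌈(m : ℝ) ^ δ⌉₊ : ℝ) * (⌈(m : ℝ) ^ δ⌉₊ - 1) / 2) *
          ((⌈(m : ℝ) ^ δ⌉₊ - 2) / (m - ⌈(m : ℝ) ^ δ⌉₊)))))) ≤ 1 / 4 := by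
  set γ : ℝ := (1 - 11 * δ) / 2 with hγ
  have hγ0 : 0 < γ := by rw [hγ]; linarith
  set n : ℕ := ⌈((c : ℝ) + 1) / γ⌉₊ with hn
  have hγn : (c : ℝ) + 1 ≤ γ * n := by
    have h := Nat.le_ceil (((c : ℝ) + 1) / γ)
    rw [← hn] at h
    rw [div_le_iff₀ hγ0] at h
    linarith
  set C₀ : ℝ := 4 * (2 : ℝ) ^ (17 * n) * (n.factorial : ℝ) with hC₀
  have hC₀pos : 0 < C₀ := by rw [hC₀]; positivity
  filter_upwards [eventually_ceil_rpow_ge_and_mul_le hδ0 (by linarith) 4, eventually_ge_atTop ⌈C₀⌉₊,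
    eventually_ge_atTop 1] with m hm4 hmC hm1
  obtain ⟨hk4, hkm⟩ := hm4
  refine ⟨hk4, hkm, ?_⟩
  -- notation
  set k : ℕ := ⌈(m : ℝ) ^ δ⌉₊ with hk
  have hK4 : (4 : ℝ) ≤ k := by exact_mod_cast hk4
  have hKm : 4 * (k : ℝ) ≤ m := by exact_mod_cast hkm
  have hm0 : (0 : ℝ) < m := by linarith
  have hmC' : C₀ ≤ m := (Nat.le_ceil C₀).trans (by exact_mod_cast hmC)
  have hxge1 : (1 : ℝ) ≤ (m : ℝ) ^ δ := Real.one_le_rpow (by exact_mod_cast hm1) hδ0.le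
  have hK2 : (k : ℝ) ≤ 2 * (m : ℝ) ^ δ := by
    have := Nat.ceil_lt_add_one (by positivity : (0 : ℝ) ≤ (m : ℝ) ^ δ)
    rw [← hk] at this
    linarith
  -- the pieces of the denominator
  set L : ℝ := 2 * (k : ℝ) ^ 2 - 4 * k + 1 with hL
  set β : ℝ := ((k : ℝ) * (k - 1) / 2) * (((k : ℝ) - 2) / ((m : ℝ) - k)) with hβ
  have hmk : (0 : ℝ) < (m : ℝ) - k := by linarith
  have hL0 : 0 < L := by rw [hL]; nlinarith
  have hLle : L ≤ 2 * (k : ℝ) ^ 2 := by rw [hL]; nlinarith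
  have hβ0 : 0 < β := by rw [hβ]; exact mul_pos (by nlinarith) (div_pos (by linarith) hmk)
  have hβle : β ≤ (k : ℝ) ^ 3 / m := by
    rw [hβ]
    have h1 : (k : ℝ) * (k - 1) / 2 ≤ (k : ℝ) ^ 2 / 2 := by nlinarith
    have h2 : ((k : ℝ) - 2) / ((m : ℝ) - k) ≤ 2 * k / m := by
      rw [div_le_div_iff₀ hmk hm0]; nlinarith
    calc (k : ℝ) * (k - 1) / 2 * (((k : ℝ) - 2) / ((m : ℝ) - k)) ≤ (k : ℝ) ^ 2 / 2 * (2 * k / m) :=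
          mul_le_mul h1 h2 (div_pos (by linarith) hmk).le (by positivity)
      _ = (k : ℝ) ^ 3 / m := by field_simp
  set D : ℝ := 512 * L ^ 2 * Real.sqrt β with hD
  have hsqβ : 0 < Real.sqrt β := Real.sqrt_pos.2 hβ0
  have hD0 : 0 < D := by rw [hD]; positivity
  -- `D² ≤ 2^33 m^{11δ - 1} ≤ (2^17 m^{-γ})²`
  have hK11 : (k : ℝ) ^ 11 ≤ 2 ^ 11 * (m : ℝ) ^ (11 * δ) := by
    calc (k : ℝ) ^ 11 ≤ (2 * (m : ℝ) ^ δ) ^ 11 := pow_le_pow_left₀ (by positivity) hK2 11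
      _ = 2 ^ 11 * ((m : ℝ) ^ δ) ^ 11 := by rw [mul_pow]
      _ = 2 ^ 11 * (m : ℝ) ^ (11 * δ) := by
          have e3 : δ * ((11 : ℕ) : ℝ) = 11 * δ := by push_cast; ring
          rw [← Real.rpow_natCast ((m : ℝ) ^ δ) 11, ← Real.rpow_mul hm0.le, e3]
  have hD2 : D ^ 2 ≤ (2 ^ 17 * (m : ℝ) ^ (-γ)) ^ 2 := by
    have hsq : D ^ 2 = 512 ^ 2 * L ^ 4 * β := by
      rw [hD, mul_pow, mul_pow, Real.sq_sqrt hβ0.le]; ring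
    have hL4 : L ^ 4 ≤ (2 * (k : ℝ) ^ 2) ^ 4 := pow_le_pow_left₀ hL0.le hLle 4
    have hrhs : (2 ^ 17 * (m : ℝ) ^ (-γ)) ^ 2 = 2 ^ 34 * (m : ℝ) ^ (11 * δ - 1) := by
      have e1 : ((2 : ℝ) ^ 17) ^ 2 = 2 ^ 34 := by norm_num
      have e2 : -γ * ((2 : ℕ) : ℝ) = 11 * δ - 1 := by rw [hγ]; push_cast; ring
      rw [mul_pow, ← Real.rpow_natCast ((m : ℝ) ^ (-γ)) 2, ← Real.rpow_mul hm0.le, e1, e2]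
    rw [hsq, hrhs]
    calc (512 : ℝ) ^ 2 * L ^ 4 * β ≤ 512 ^ 2 * (2 * (k : ℝ) ^ 2) ^ 4 * ((k : ℝ) ^ 3 / m) :=
          mul_le_mul (mul_le_mul_of_nonneg_left hL4 (by positivity)) hβle hβ0.le (by positivity)
      _ = 2 ^ 22 * (k : ℝ) ^ 11 / m := by ring
      _ ≤ 2 ^ 22 * (2 ^ 11 * (m : ℝ) ^ (11 * δ)) / m := by gcongr
      _ = 2 ^ 33 * (m : ℝ) ^ (11 * δ - 1) := by
          rw [Real.rpow_sub_one hm0.ne']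
          ring
      _ ≤ 2 ^ 34 * (m : ℝ) ^ (11 * δ - 1) := by
          have : (0 : ℝ) ≤ (m : ℝ) ^ (11 * δ - 1) := by positivity
          nlinarith
  have hDle : D ≤ 2 ^ 17 * (m : ℝ) ^ (-γ) :=
    (pow_le_pow_iff_left₀ hD0.le (by positivity) two_ne_zero).1 hD2
  -- the exponent `E = 1/D ≥ m^γ / 2^17`
  have hE : (m : ℝ) ^ γ / 2 ^ 17 ≤ 1 / D := by
    rw [div_le_div_iff₀ (by positivity) hD0]
    calc (m : ℝ) ^ γ * D ≤ (m : ℝ) ^ γ * (2 ^ 17 * (m : ℝ) ^ (-γ)) := mul_le_mul_of_nonneg_left hDle (by positivity)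
      _ = 1 * 2 ^ 17 := by
          rw [Real.rpow_neg hm0.le, mul_comm (2 ^ 17 : ℝ), ← mul_assoc,
            mul_inv_cancel₀ (Real.rpow_pos_of_pos hm0 γ).ne']
  -- `exp E ≥ m^{c+1} / (2^{17 n} n!)`
  have hEpos : 0 ≤ (m : ℝ) ^ γ / 2 ^ 17 := by positivity
  have hexp : (m : ℝ) ^ (c + 1) / ((2 : ℝ) ^ (17 * n) * n.factorial) ≤ Real.exp (1 / D) := by
    have h1 : ((m : ℝ) ^ γ / 2 ^ 17) ^ n / n.factorial ≤ Real.exp ((m : ℝ) ^ γ / 2 ^ 17) :=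
      Real.pow_div_factorial_le_exp _ hEpos n
    have h2 : Real.exp ((m : ℝ) ^ γ / 2 ^ 17) ≤ Real.exp (1 / D) := Real.exp_le_exp.2 hE
    have h3 : (m : ℝ) ^ (c + 1) ≤ ((m : ℝ) ^ γ) ^ n := by
      rw [← Real.rpow_natCast ((m : ℝ) ^ γ) n, ← Real.rpow_mul hm0.le, ← Real.rpow_natCast (m : ℝ) (c + 1)]
      refine Real.rpow_le_rpow_of_exponent_le (by exact_mod_cast hm1) ?_
      push_cast
      exact hγn
    calc (m : ℝ) ^ (c + 1) / ((2 : ℝ) ^ (17 * n) * n.factorial)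
        ≤ ((m : ℝ) ^ γ) ^ n / ((2 : ℝ) ^ (17 * n) * n.factorial) :=
          div_le_div_of_nonneg_right h3 (by positivity)
      _ = ((m : ℝ) ^ γ / 2 ^ 17) ^ n / n.factorial := by
          rw [div_pow, pow_mul]; field_simp
      _ ≤ Real.exp (1 / D) := h1.trans h2
  -- conclude
  have hexppos : 0 < Real.exp (1 / D) := Real.exp_pos _
  rw [show -(1 / D) = -(1 / D) from rfl, Real.exp_neg]
  rw [← div_eq_mul_inv, div_le_iff₀ hexppos]
  have hden : 0 < (2 : ℝ) ^ (17 * n) * n.factorial := by positivity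
  calc (m : ℝ) ^ c = ((m : ℝ) ^ (c + 1) / ((2 : ℝ) ^ (17 * n) * n.factorial)) *
        (((2 : ℝ) ^ (17 * n) * n.factorial) / m) := by
        field_simp; ring
    _ ≤ Real.exp (1 / D) * (((2 : ℝ) ^ (17 * n) * n.factorial) / m) :=
        mul_le_mul_of_nonneg_right hexp (by positivity)
    _ ≤ Real.exp (1 / D) * (1 / 4) := by
        refine mul_le_mul_of_nonneg_left ?_ hexppos.le
        rw [div_le_div_iff₀ hm0 (by norm_num)]
        rw [hC₀] at hmC'
        linarith
    _ = 1 / 4 * Real.exp (1 / D) := by ring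

/-! ## The eventual form -/

/-- **The column-space LP slice of the crux holds (every `δ ∈ (0, 1/11)`, every `c`).** Eventually in `m`
(`k = ⌈m^δ⌉₊`), for every `ε > 0`, every `R ≤ m^c`, all `b ≥ 0` and all edge weightings `t₁,…,t_R` that are
`k`-clique-non-negative (`t_l(E(Q)) ≥ 0`), the identity `cdist Q u − ε = ∑_l b_l(u)·t_l(E(Q))` FAILS for some `k`-set `Q`
and some `k`-clique-free `u`: no polynomial-size non-negative factorisation of `D − εJ` has its row objects in the column
space `span{[e ⊆ Q]}` of `D`. [new] -/
theorem columnSpace_cliqueDistConeRankHard {δ : ℝ} (hδ0 : 0 < δ) (hδ1 : δ < 1 / 11) (c : ℕ) :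
    ∀ᶠ m : ℕ in atTop, ∀ ε : ℝ, 0 < ε → ∀ R : ℕ, R ≤ m ^ c →
      ∀ (t : Fin R → Edge m → ℝ) (b : (Edge m → Bool) → Fin R → ℝ),
      (∀ l (Q : Finset (Fin m)), Q.card = ⌈(m : ℝ) ^ δ⌉₊ → 0 ≤ ∑ e, if cliqueVec Q e = true then t l e else 0) →
      (∀ u l, 0 ≤ b u l) →
      ¬ ∀ (Q : Finset (Fin m)) (u : Edge m → Bool), Q.card = ⌈(m : ℝ) ^ δ⌉₊ → cliqueFn m ⌈(m : ℝ) ^ δ⌉₊ u = false →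
          cdist Q u - ε = ∑ l, b u l * ∑ e, (if cliqueVec Q e = true then t l e else 0) := by
  filter_upwards [eventually_catch_exponent hδ0 hδ1 c] with m hm
  obtain ⟨hk4, hkm, hsmall⟩ := hm
  intro ε hε R hR t b ht hb hall
  set k : ℕ := ⌈(m : ℝ) ^ δ⌉₊ with hk
  have hkm2 : k + 2 ≤ m := by omega
  have hlb := restricted_terms_lower_bound hk4 hkm2 t ht b hb ε hε hall
  -- abbreviate `q = k - 1 ≥ 3` and the catch factor `θ ≤ 1/(4 m^c)`
  set θ : ℝ := Real.exp (-(1 / (512 * (2 * (k : ℝ) ^ 2 - 4 * k + 1) ^ 2 *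
    Real.sqrt (((k : ℝ) * (k - 1) / 2) * ((k - 2) / (m - k)))))) with hθ
  have hθ0 : 0 < θ := Real.exp_pos _
  have hq3 : (3 : ℝ) ≤ ((k - 1 : ℕ) : ℝ) := by
    have : 3 ≤ k - 1 := by omega
    exact_mod_cast this
  set qm : ℝ := ((k - 1 : ℕ) : ℝ) ^ m with hqm
  have hqm0 : 0 < qm := by rw [hqm]; positivity
  -- `q ≤ qm / 2`
  have hq_le : ((k - 1 : ℕ) : ℝ) ≤ qm / 2 := by
    have hm2 : 2 ≤ m := by omega
    obtain ⟨m', hm'⟩ : ∃ m', m = m' + 2 := ⟨m - 2, by omega⟩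
    rw [hqm, hm', pow_succ, pow_succ]
    have h1 : (1 : ℝ) ≤ ((k - 1 : ℕ) : ℝ) ^ m' := one_le_pow₀ (by linarith)
    have hQ0 : (0 : ℝ) ≤ ((k - 1 : ℕ) : ℝ) := by positivity
    have h2 := mul_le_mul h1 hq3 (by norm_num) (by positivity)
    have h3 := mul_le_mul_of_nonneg_right h2 hQ0
    linarith
  -- `R θ ≤ m^c θ ≤ 1/4`
  have hRθ : (R : ℝ) * (qm * θ) ≤ qm / 4 := by
    have hR' : (R : ℝ) ≤ (m : ℝ) ^ c := by exact_mod_cast hR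
    calc (R : ℝ) * (qm * θ) ≤ (m : ℝ) ^ c * (qm * θ) := mul_le_mul_of_nonneg_right hR' (by positivity)
      _ = qm * ((m : ℝ) ^ c * θ) := by ring
      _ ≤ qm * (1 / 4) := mul_le_mul_of_nonneg_left hsmall hqm0.le
      _ = qm / 4 := by ring
  -- contradiction: `qm - qm/2 ≤ qm/4`
  linarith

/-- **The column-space LP slice of the crux** (registered form of `columnSpace_cliqueDistConeRankHard`). [new] -/
theorem columnSpace_crux : ∀ (δ : ℝ), 0 < δ → δ < 1 / 11 → ∀ c : ℕ, ∀ᶠ m : ℕ in Filter.atTop, ∀ ε : ℝ, 0 < ε → ∀ R : ℕ, R ≤ m ^ c → ∀ (t : Fin R → Edge m → ℝ) (b : (Edge m → Bool) → Fin R → ℝ), (∀ l (Q : Finset (Fin m)), Q.card = ⌈(m : ℝ) ^ δ⌉₊ → 0 ≤ ∑ e, if cliqueVec Q e = true then t l e else 0) → (∀ u l, 0 ≤ b u l) → ¬ ∀ (Q : Finset (Fin m)) (u : Edge m → Bool), Q.card = ⌈(m : ℝ) ^ δ⌉₊ → cliqueFn m ⌈(m : ℝ) ^ δ⌉₊ u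 = false → cdist Q u - ε = ∑ l, b u l * ∑ e, (if cliqueVec Q e = true then t l e else 0) :=
  fun _ hδ0 hδ1 c => columnSpace_cliqueDistConeRankHard hδ0 hδ1 c

end

end Summit.PneNP.PneNP.Theorems
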